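import Summits.CriticalPhenomena.PercolationContinuityZ3.Theorems.PercNearOneGluingNoHeavyLowerTailSahiAllButOne
import Literature.Probability.Percolation.TwoClusterConditionalSahi

/-!
# `NoHeavyLowerTail` (crux stmt-CriticalPhenomena-4575), Sahi / Kahn positivity: the ALL-BUT-ONE slot (IV) — event form, all parameters

Support file (cell `prim-l12`, seat P3, gen 8; `--supports stmt-CriticalPhenomena-4575`).  No `sorry`, no named facts, standard axioms.
New mathematics (this programme; the closure lemma is folklore).

* `sahiE_nonneg_of_interior` (folklore closure argument): `p ↦ E_n^{μ_p}(F)` is continuous in the parameters (`continuous_sahiE_param`), and every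
  parameter vector is the limit of vectors whose coordinates on a given set `A` lie in `(0,1)` (`clampSeq`, `tendsto_clampSeq`); hence an
  inequality `0 ≤ E_n` proved for parameters interior on `A` holds for all parameters.
* `allButOneEvent A = {ω : at most one coordinate of A is closed}`, its block structure, and **`sahiE_three_allButOneEvent_nonneg`**: for every block
  `e : Fin k ↪ ι` (`k ≥ 1`), EVERY `p : ι → [0,1]` and all increasing `U, V`, `E₃(1_{allButOneEvent(range e)}, 1_U, 1_V) ≥ 0` — Kahn's Conjecture 5 /
  Sahi's `C₃` for the all-but-one first slot with no restriction on the parameters (from `…SahiAllButOne.sahiE_three_nonneg_of_allButOne`). [this work]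
-/

noncomputable section

open scoped Classical Topology
open Filter

namespace Summit.CriticalPhenomena.PercolationContinuityZ3.Theorems

namespace SahiAllButOne

open Finset
open SahiHittingSlot SahiTransportCert
open Literature.Combinatorics.Sahi2008
open Literature.Probability.Percolation (DeterminedBy determinedBy_iff)
open Literature.Probability.Percolation.BHK2006 (weight)
open Literature.Probability.Percolation.DecisionTree (ind ind_of_mem ind_of_not_mem ind_nonneg)

variable {ι : Type} {k : ℕ}

/-! ### Continuity in the parameters and the closure argument -/

/-- The product weight is continuous in the parameter vector. [folklore] -/
theorem continuous_bernoulliWeight [Fintype ι] : Continuous fun p : ι → unitInterval => bernoulliWeight p := by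
  refine continuous_pi fun ω => ?_
  show Continuous fun p : ι → unitInterval => ∏ e, (if e ∈ ω then (p e : ℝ) else 1 - (p e : ℝ))
  refine continuous_finsetProd _ fun e _ => ?_
  by_cases h : e ∈ ω
  · simp only [h, if_true]; exact continuous_subtype_val.comp (continuous_apply e)
  · simp only [h, if_false]; exact continuous_const.sub (continuous_subtype_val.comp (continuous_apply e))

/-- `p ↦ E_n^{μ_p}(F)` is continuous. [folklore] -/
theorem continuous_sahiE_param [Fintype ι] (n : ℕ) (F : Fin n → Set ι → ℝ) :
    Continuous fun p : ι → unitInterval => sahiE (bernoulliWeight p) n F :=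
  (Literature.Probability.Percolation.BHK2006.continuous_sahiE n F).comp continuous_bernoulliWeight

/-- The clamping levels `t_n = 1/(2(n+1)) ∈ (0, 1/2]`. [folklore] -/
def tseq (n : ℕ) : ℝ := (1 / 2) * (1 / ((n : ℝ) + 1))

/-- `t_n > 0`. [folklore] -/
theorem tseq_pos (n : ℕ) : 0 < tseq n := by unfold tseq; positivity

/-- `t_n ≤ 1/2`. [folklore] -/
theorem tseq_le_half (n : ℕ) : tseq n ≤ 1 / 2 := by
  unfold tseq
  have h1 : (1 : ℝ) / ((n : ℝ) + 1) ≤ 1 := by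
    rw [div_le_one (by positivity)]; linarith [(Nat.cast_nonneg n : (0:ℝ) ≤ n)]
  linarith [mul_le_mul_of_nonneg_left h1 (by norm_num : (0:ℝ) ≤ 1/2)]

/-- `t_n → 0`. [folklore] -/
theorem tendsto_tseq : Tendsto tseq atTop (𝓝 0) := by
  have h := (tendsto_one_div_add_atTop_nhds_zero_nat (𝕜 := ℝ)).const_mul (1 / 2 : ℝ)
  rw [mul_zero] at h
  exact h

/-- Clamping a number of `[0,1]` into `[t_n, 1 − t_n]`. [folklore] -/
def clampVal (n : ℕ) (x : ℝ) : ℝ := max (tseq n) (min (1 - tseq n) x)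

/-- The clamped value is at least `t_n`. [folklore] -/
theorem tseq_le_clampVal (n : ℕ) (x : ℝ) : tseq n ≤ clampVal n x := le_max_left _ _

/-- The clamped value is at most `1 − t_n`. [folklore] -/
theorem clampVal_le (n : ℕ) (x : ℝ) : clampVal n x ≤ 1 - tseq n :=
  max_le (by linarith [tseq_le_half n]) (min_le_left _ _)

/-- The clamped value lies in `[0,1]`. [folklore] -/
theorem clampVal_mem (n : ℕ) (x : ℝ) : clampVal n x ∈ unitInterval :=
  ⟨(tseq_pos n).le.trans (tseq_le_clampVal n x), (clampVal_le n x).trans (by linarith [tseq_pos n])⟩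

/-- The clamped value is within `t_n` of the original. [folklore] -/
theorem abs_clampVal_sub_le (n : ℕ) {x : ℝ} (hx : x ∈ unitInterval) : x - tseq n ≤ clampVal n x ∧ clampVal n x ≤ x + tseq n := by
  obtain ⟨h0, h1⟩ := hx
  have ht := tseq_pos n
  constructor
  · exact le_trans (le_min (by linarith) (by linarith)) (le_max_right _ _)
  · exact max_le (by linarith) ((min_le_right _ _).trans (by linarith))

/-- The clamped parameter vectors: coordinates in `A` moved into `[t_n, 1 − t_n]`, the others unchanged. [folklore] -/
def clampSeq (A : Set ι) (p : ι → unitInterval) (n : ℕ) : ι → unitInterval :=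
  fun j => if j ∈ A then ⟨clampVal n (p j : ℝ), clampVal_mem n (p j : ℝ)⟩ else p j

/-- The clamped parameters are interior on `A`. [folklore] -/
theorem clampSeq_interior (A : Set ι) (p : ι → unitInterval) (n : ℕ) {a : ι} (ha : a ∈ A) :
    0 < (clampSeq A p n a : ℝ) ∧ (clampSeq A p n a : ℝ) < 1 := by
  unfold clampSeq
  rw [if_pos ha]
  exact ⟨(tseq_pos n).trans_le (tseq_le_clampVal n _), (clampVal_le n _).trans_lt (by linarith [tseq_pos n])⟩

/-- The clamped parameters converge to the original ones. [folklore] -/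
theorem tendsto_clampSeq (A : Set ι) (p : ι → unitInterval) : Tendsto (clampSeq A p) atTop (𝓝 p) := by
  rw [tendsto_pi_nhds]
  intro j
  rw [tendsto_subtype_rng]
  by_cases hj : j ∈ A
  · have hev : ∀ n, (clampSeq A p n j : ℝ) = clampVal n (p j : ℝ) := fun n => by unfold clampSeq; rw [if_pos hj]
    simp only [hev]
    have hlo : Tendsto (fun n => (p j : ℝ) - tseq n) atTop (𝓝 (p j : ℝ)) := by
      have := tendsto_const_nhds (x := (p j : ℝ)) (f := (atTop : Filter ℕ)) |>.sub tendsto_tseq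
      rwa [sub_zero] at this
    have hhi : Tendsto (fun n => (p j : ℝ) + tseq n) atTop (𝓝 (p j : ℝ)) := by
      have := tendsto_const_nhds (x := (p j : ℝ)) (f := (atTop : Filter ℕ)) |>.add tendsto_tseq
      rwa [add_zero] at this
    exact tendsto_of_tendsto_of_tendsto_of_le_of_le hlo hhi (fun n => (abs_clampVal_sub_le n (p j).2).1)
      (fun n => (abs_clampVal_sub_le n (p j).2).2)
  · have hev : ∀ n, clampSeq A p n j = p j := fun n => by unfold clampSeq; rw [if_neg hj]
    simp only [hev]
    exact tendsto_const_nhds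

/-- **Closure argument.**  An inequality `0 ≤ E_n^{μ_p}(F)` valid for all parameter vectors that are interior on `A` holds for every parameter
vector. [folklore] -/
theorem sahiE_nonneg_of_interior [Fintype ι] (A : Set ι) {n : ℕ} (F : Fin n → Set ι → ℝ)
    (h : ∀ p' : ι → unitInterval, (∀ a ∈ A, 0 < (p' a : ℝ) ∧ (p' a : ℝ) < 1) → 0 ≤ sahiE (bernoulliWeight p') n F)
    (p : ι → unitInterval) : 0 ≤ sahiE (bernoulliWeight p) n F :=
  ge_of_tendsto (((continuous_sahiE_param n F).tendsto p).comp (tendsto_clampSeq A p))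
    (Eventually.of_forall fun m => h _ fun _ ha => clampSeq_interior A p m ha)

/-! ### The all-but-one event of a block and the theorem for all parameters -/

/-- The all-but-one event of a block `A ⊆ ι`: at most one coordinate of `A` is closed. [this work] -/
def allButOneEvent (A : Set ι) : Set (Set ι) := {ω | ∀ a ∈ A, ∀ b ∈ A, a ∉ ω → b ∉ ω → a = b}

/-- The all-but-one event is increasing. [this work] -/
theorem isUpperSet_allButOneEvent (A : Set ι) : IsUpperSet (allButOneEvent A) :=
  fun _ _ hle hω a ha b hb haω hbω => hω a ha b hb (fun h => haω (hle h)) (fun h => hbω (hle h))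

/-- The all-but-one event of `range e` is determined by the block. [this work] -/
theorem determinedBy_allButOneEvent (e : Fin k ↪ ι) : DeterminedBy (allButOneEvent (Set.range e)) (Set.range e) := by
  rw [determinedBy_iff]
  intro ω ω' h
  have key : ∀ a ∈ Set.range e, (a ∈ ω ↔ a ∈ ω') := fun a ha => by
    constructor
    · intro hω; have : a ∈ ω ∩ Set.range e := ⟨hω, ha⟩; rw [h] at this; exact this.1
    · intro hω'; have : a ∈ ω' ∩ Set.range e := ⟨hω', ha⟩; rw [← h] at this; exact this.1
  simp only [allButOneEvent, Set.mem_setOf_eq]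
  constructor
  · intro H a ha b hb haω hbω; exact H a ha b hb (fun h' => haω ((key a ha).1 h')) (fun h' => hbω ((key b hb).1 h'))
  · intro H a ha b hb haω hbω; exact H a ha b hb (fun h' => haω ((key a ha).2 h')) (fun h' => hbω ((key b hb).2 h'))

/-- Its pattern event is `allButOne k`. [this work] -/
theorem pat_allButOneEvent (e : Fin k ↪ ι) : pat e (allButOneEvent (Set.range e)) = allButOne k := by
  ext S
  simp only [pat, allButOneEvent, allButOne, Set.mem_setOf_eq]
  constructor
  · intro H i j hi hj
    exact e.injective (H (e i) ⟨i, rfl⟩ (e j) ⟨j, rfl⟩ (fun h => hi (by obtain ⟨i', hi', hii'⟩ := h; exact e.injective hii' ▸ hi'))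
      (fun h => hj (by obtain ⟨j', hj', hjj'⟩ := h; exact e.injective hjj' ▸ hj')))
  · rintro H a ⟨i, rfl⟩ b ⟨j, rfl⟩ hi hj
    rw [H i j (fun h => hi ⟨i, h, rfl⟩) (fun h => hj ⟨j, h, rfl⟩)]

/-- **The all-but-one slot theorem, event form.**  For every block `e : Fin k ↪ ι` (`k ≥ 1`) with parameters in `(0,1)` on the block
and all increasing `U, V`: `E₃(1_{allButOneEvent(range e)}, 1_U, 1_V) ≥ 0`. [this work] -/
theorem sahiE_three_allButOneEvent_nonneg [Fintype ι] (p : ι → unitInterval) (e : Fin k ↪ ι) (hk : 0 < k)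
    (hp : ∀ i, 0 < (p (e i) : ℝ) ∧ (p (e i) : ℝ) < 1) {U V : Set (Set ι)} (hU : IsUpperSet U) (hV : IsUpperSet V) :
    0 ≤ sahiE (bernoulliWeight p) 3 ![ind (allButOneEvent (Set.range e)), ind U, ind V] :=
  sahiE_three_nonneg_of_allButOne p e hk hp (determinedBy_allButOneEvent e) (pat_allButOneEvent e) hU hV


/-- **THE ALL-BUT-ONE SLOT THEOREM FOR ALL PARAMETERS.**  For every block `e : Fin k ↪ ι` (`k ≥ 1`), every `p : ι → [0,1]` and all increasing
`U, V`: `E₃(1_{allButOneEvent(range e)}, 1_U, 1_V) ≥ 0`. [this work] -/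
theorem sahiE_three_allButOneEvent_nonneg' [Fintype ι] (p : ι → unitInterval) (e : Fin k ↪ ι) (hk : 0 < k)
    {U V : Set (Set ι)} (hU : IsUpperSet U) (hV : IsUpperSet V) :
    0 ≤ sahiE (bernoulliWeight p) 3 ![ind (allButOneEvent (Set.range e)), ind U, ind V] :=
  sahiE_nonneg_of_interior (Set.range e) _
    (fun p' hp' => sahiE_three_allButOneEvent_nonneg p' e hk (fun i => hp' (e i) ⟨i, rfl⟩) hU hV) p

end SahiAllButOne

end Summit.CriticalPhenomena.PercolationContinuityZ3.Theorems
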